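import Literature.AnabelianGeometry.AbsoluteAnabelian.LocalReciprocityVerlagerung
import Literature.NumberTheory.GaloisRepresentations.ArtinRestriction
import HarnessLib

/-!
# An injective open homomorphism into `G_k` is, up to an inner automorphism, the restriction map of a
# finite extension composed with an isomorphism

S. Mochizuki, *Topics in Absolute Anabelian Geometry III*, Cor. 1.10 (i) p. 42: «the asserted
"functoriality" is with respect to arbitrary injective open homomorphisms of profinite groups [cf. also
Remark 1.10.1, (iii)]»; Rmk. 1.10.1 (iii) / Rmk. 3.2.2: for an open injection the compatibility is «relative
to dividing … by a factor given by the index of the image».  The tree states the functoriality of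
Cor. 1.10 (i)(a)/(b) along (1) ISOMORPHISMS of topological groups `G_{k₁} ≃ₜ* G_{k₂}` and (2) the restriction
maps `res : G_{k′} ↪ G_k` of finite extensions `k′/k` (`absGaloisRestrict k k′`; abc-iut-L4-d1
`AbsTopIII.Cor_1_10_i_a_resNatural`, abc-iut-L4-d3 `cor_1_10_i_b_resNatural_of_compatible`, abc-iut-w5-d201
`galCyclotomeRes`).  This PROOF-ONLY file (no definition, no named fact) records why (1)+(2) exhaust
print's «arbitrary injective open homomorphisms» into an absolute Galois group:

* `exists_eq_conj_absGaloisRestrict_comp` — for ANY compact topological group `H` and ANY injective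
  continuous homomorphism `β : H → G_k` with open image there are a finite subextension `L ⊆ k̄` of `k`
  (the fixed field of `β(H)`), an isomorphism of topological groups `α : H ≃ₜ* G_L` and `g ∈ G_k` with
  `β = Inn(g) ∘ res_{L/k} ∘ α`, and `[L : k] = [G_k : β(H)]` — the «index of the image».

Ingredients (all in tree): the fixed field of an open subgroup is finite with degree the index
(`finrank_fixedField_of_isOpen`), the image of `res_{L/k}` is a conjugate of the subgroup
(`exists_mem_range_absGaloisRestrict_fixedField_iff`, the chosen embedding `k̄ → L̄` being unique up to
`G_k`), `Gal(k̄/L₀) ≅ G_L` topologically (`exists_continuousMulEquiv_galFixing_embField`), and a continuous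
bijection from a compact to a Hausdorff group is a homeomorphism.  Classical (Krull topology,
Neukirch IV §1); nothing here bears on [IUTchIII] Cor. 3.12.
-/

noncomputable section

open Function Field IntermediateField

universe u

namespace Literature.AnabelianGeometry.AbsoluteAnabelian

open Literature.NumberTheory.GaloisRepresentations
open Literature.NumberTheory.GaloisRepresentations.LocalWeilDatum

variable {k : Type u} [Field k] [CharZero k]
  {H : Type u} [Group H] [TopologicalSpace H] [CompactSpace H]

/-- **Every injective open homomorphism into `G_k` factors, up to `Inn(G_k)`, as an isomorphism onto
`G_L` followed by `res_{L/k}`**, `L = k̄^{β(H)}` finite over `k` with `[L : k] = [G_k : β(H)]`.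
[cite: MochizukiAbsTopIII2015, Remark 1.10.1 (iii) p.44] [cite: NeukirchANT1999, Ch. IV §1] -/
theorem exists_eq_conj_absGaloisRestrict_comp (β : H →ₜ* absoluteGaloisGroup k) (hinj : Injective β)
    (hopen : IsOpen (Set.range β)) :
    ∃ (L : IntermediateField k (AlgebraicClosure k)) (_ : FiniteDimensional k L)
      (α : H ≃ₜ* absoluteGaloisGroup L) (g : absoluteGaloisGroup k),
      (∀ σ : H, β σ = g * absGaloisRestrict k L (α σ) * g⁻¹) ∧
        Module.finrank k L = β.toMonoidHom.range.index := by
  classical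
  set U : Subgroup (absoluteGaloisGroup k) := β.toMonoidHom.range with hUdef
  have hU : IsOpen (U : Set (absoluteGaloisGroup k)) := hopen
  set L : IntermediateField k (AlgebraicClosure k) := fixedField U with hL
  haveI hfin : FiniteDimensional k L := finiteDimensional_fixedField_of_isOpen U hU
  -- the image of `res_{L/k}` is a conjugate `g⁻¹ ? g`-twist of `U`
  obtain ⟨g₀, hg₀⟩ := exists_mem_range_absGaloisRestrict_fixedField_iff U hU
  -- `Gal(k̄/L₀) = range res_{L/k} ≅ G_L`
  obtain ⟨Φ, hΦ⟩ := exists_continuousMulEquiv_galFixing_embField k L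
  have hrange : galFixing k (embField k L) = (absGaloisRestrict k L).range := galFixing_embField_eq_range k L
  -- conjugating `β` by `g₀` lands in `Gal(k̄/L₀)`
  have hmem : ∀ σ : H, g₀ * β σ * g₀⁻¹ ∈ galFixing k (embField k L) := fun σ => by
    rw [hrange, hg₀]
    have hσU : β σ ∈ U := ⟨σ, rfl⟩
    have hrew : g₀⁻¹ * (g₀ * β σ * g₀⁻¹) * g₀ = β σ := by group
    rw [hrew]
    exact hσU
  -- the homomorphism `α₀ : H → G_L`, `σ ↦ Φ (g₀ β σ g₀⁻¹)`
  let c : H →* galFixing k (embField k L) :=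
    { toFun := fun σ => ⟨g₀ * β σ * g₀⁻¹, hmem σ⟩
      map_one' := Subtype.ext (by simp)
      map_mul' := fun a b => Subtype.ext (by
        change g₀ * β (a * b) * g₀⁻¹ = g₀ * β a * g₀⁻¹ * (g₀ * β b * g₀⁻¹)
        rw [map_mul]; group) }
  have hc : Continuous c := by
    refine Continuous.subtype_mk ?_ _
    exact (continuous_const.mul β.continuous).mul continuous_const
  let α₀ : H →* absoluteGaloisGroup L := Φ.toMonoidHom.comp c
  have hα₀c : Continuous α₀ := Φ.continuous.comp hc
  have hα₀inj : Injective α₀ := by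
    intro a b hab
    have h1 : c a = c b := Φ.injective hab
    have h2 : g₀ * β a * g₀⁻¹ = g₀ * β b * g₀⁻¹ := congrArg Subtype.val h1
    exact hinj (by simpa using h2)
  have hα₀surj : Surjective α₀ := by
    intro τ
    obtain ⟨γ, hγ⟩ : ∃ γ : galFixing k (embField k L), Φ γ = τ := Φ.surjective τ
    have hγU : g₀⁻¹ * (γ : absoluteGaloisGroup k) * g₀ ∈ U := by
      rw [← hg₀, ← hrange]; exact γ.2
    obtain ⟨σ, hσ⟩ := hγU
    refine ⟨σ, ?_⟩
    change Φ (c σ) = τ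
    rw [← hγ]
    congr 1
    apply Subtype.ext
    change g₀ * β σ * g₀⁻¹ = γ
    have hσ' : (β σ : absoluteGaloisGroup k) = g₀⁻¹ * (γ : absoluteGaloisGroup k) * g₀ := hσ
    rw [hσ']; group
  -- upgrade to an isomorphism of topological groups (compact → Hausdorff)
  let e : H ≃* absoluteGaloisGroup L := MulEquiv.ofBijective α₀ ⟨hα₀inj, hα₀surj⟩
  let eₜ : H ≃ₜ absoluteGaloisGroup L := hα₀c.homeoOfEquivCompactToT2 (f := e.toEquiv)
  let α : H ≃ₜ* absoluteGaloisGroup L :=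
    { e with continuous_toFun := hα₀c, continuous_invFun := eₜ.symm.continuous }
  refine ⟨L, hfin, α, g₀⁻¹, fun σ => ?_, ?_⟩
  · -- `res (α σ) = res (liftGal (g₀ β σ g₀⁻¹)) = g₀ β σ g₀⁻¹`
    have h1 : absGaloisRestrict k L (α σ) = g₀ * β σ * g₀⁻¹ := by
      change absGaloisRestrict k L (Φ (c σ)) = _
      rw [hΦ, absGaloisRestrict_liftGal]
      rfl
    rw [h1, inv_inv]; group
  · exact finrank_fixedField_of_isOpen U hU

end Literature.AnabelianGeometry.AbsoluteAnabelian
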